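import Mathlib
import Summits.NavierStokesRegularity.NavierStokesRegularity.Theorems.EulerZoomLiouvillePowerGaugeEulerLiouvilleSpiralProfileEquationTools
import HarnessLib

/-!
# Crux `EulerZoomLiouville.PowerGaugeEulerLiouville` (stmt-NavierStokesRegularity-19832), width sub-line `relative_equilibria`
# (ns-idea-11), R3a port recipe step P6, II: Fubini for the rotated dilation and the tested integrand of a spiral pair

Route №10 `EulerZoomLiouville` (NavierStokesRegularity), crux E.  Seat ns-ezl-w2 g8 (`--supports stmt-19832 --as helper`).
Continuation of `…SpiralProfileEquationTools`:

* `measurable_spiralMap` — `(t,x) ↦ e^{−(log(−t))S}((−t)^{−γ}x)` is Borel measurable (bilinear evaluation of a continuous operator path);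
  `quasiMeasurePreserving_spiralMap` — it is quasi-measure-preserving from the slab `(−∞,0) × ℝ³` to `ℝ³` (each slice = rotation ∘ dilation);
* `integral_slab_mul_comp_spiral` — **Fubini for one rotated–dilated term on the slab**: for `g ∈ L¹(ℝ³)`, a continuous weight `α` supported in
  `(a,b)`, `b < 0`, and `S` skew: `(t,x) ↦ α(t) g(e^{−(log(−t))S}((−t)^{−γ}x))` is integrable on the slab and
  `∫∫ α(t) g(e^{−(log(−t))S}((−t)^{−γ}x)) dx dt = (∫ α(t)(−t)^{3γ} dt)(∫ g)` — the untwisted `ProfileEquation.integral_slab_mul_comp_dilation`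
  plus rotation invariance of Lebesgue measure (`Killing.integral_comp_expSkew`);
* `tested_integrand_spiral` — the POINTWISE form of the tested integrand of a spiral pair `u = λ^{γ−1}Q V(z)`, `p = λ^{2γ−2}P(z)`
  (`λ = −t`, `Q = e^{(log λ)S}`, `z = Q⁻¹λ^{−γ}x`) against the spiral test field `Ψ = χ Q η(z)`:
  `⟪u,∂ₜΨ⟫ + ⟪u,DΨ u⟫ + p div Ψ = χ'λ^{γ−1}⟪V,η⟫ + γχλ^{γ−2}⟪V,Dη z⟫ + χλ^{γ−2}(⟪V,Dη V⟫ + P div η) + χλ^{γ−2}(⟪V, Dη(S z)⟫ + ⟪S V, η⟫)`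
  (all profile quantities at `z`; the last bracket is the spiral correction; `Q` drops out of every inner product by isometry).

The identity itself is in part III (`…SpiralProfileEquation`).  WHAT THIS IS NOT: not NS, not E, no stub closed — measure/algebra tools for a brick
of a width sub-line; 19832 OPEN.  [folklore; ChaeTsai2013DSS p. 4]
-/

noncomputable section

set_option linter.dupNamespace false

open MeasureTheory Set Filter Topology Metric Function TopologicalSpace
open scoped ENNReal NNReal RealInnerProductSpace ContDiff

namespace Summit.NavierStokesRegularity.NavierStokesRegularity.Theorems.PowerGaugeEulerLiouville

open Literature.Analysis Literature.Analysis.FunctionSpaces Literature.Analysis.FluidPDE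
open Summit.NavierStokesRegularity.NavierStokesRegularity.Theorems.CoriolisHead

namespace SpiralProfileEquation

variable {S : EuclideanSpace ℝ (Fin 3) →L[ℝ] EuclideanSpace ℝ (Fin 3)}

/-! ## The rotated dilation `(t, x) ↦ e^{−(log(−t))S}((−t)^{−γ} x)` as a map of measure spaces -/

section SpiralMap

/-- The rotated dilation `(t,x) ↦ e^{−(log(−t))S}((−t)^{−γ}x)` is Borel measurable on `ℝ × ℝ³` (continuous operator path evaluated at a
measurable vector: bounded bilinear evaluation). [folklore] -/
theorem measurable_spiralMap (S : EuclideanSpace ℝ (Fin 3) →L[ℝ] EuclideanSpace ℝ (Fin 3)) (γ : ℝ) :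
    Measurable (fun z : ℝ × EuclideanSpace ℝ (Fin 3) =>
      NormedSpace.exp ((-Real.log (-z.1)) • S) ((-z.1) ^ (-γ) • z.2)) := by
  have h1 : Measurable (fun z : ℝ × EuclideanSpace ℝ (Fin 3) => NormedSpace.exp ((-Real.log (-z.1)) • S)) :=
    ((contDiff_expSkew S (n := 0)).continuous.measurable).comp
      ((Real.measurable_log.comp measurable_fst.neg).neg)
  have h2 : Measurable (fun z : ℝ × EuclideanSpace ℝ (Fin 3) => (-z.1) ^ (-γ) • z.2) :=
    (measurable_fst.neg.pow_const _).smul measurable_snd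
  have hev : Measurable (fun q : (EuclideanSpace ℝ (Fin 3) →L[ℝ] EuclideanSpace ℝ (Fin 3)) × EuclideanSpace ℝ (Fin 3) =>
      q.1 q.2) :=
    (isBoundedBilinearMap_apply (𝕜 := ℝ) (E := EuclideanSpace ℝ (Fin 3)) (F := EuclideanSpace ℝ (Fin 3))).continuous.measurable
  exact hev.comp (h1.prodMk h2)

/-- The rotated dilation is quasi-measure-preserving from the slab `(−∞,0) × ℝ³` (product Lebesgue measure) to `ℝ³`: each slice is a
dilation followed by a rotation. [folklore] -/
theorem quasiMeasurePreserving_spiralMap (hS : ∀ x y : EuclideanSpace ℝ (Fin 3), ⟪S x, y⟫ = -⟪x, S y⟫) (γ : ℝ) :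
    Measure.QuasiMeasurePreserving
      (fun z : ℝ × EuclideanSpace ℝ (Fin 3) => NormedSpace.exp ((-Real.log (-z.1)) • S) ((-z.1) ^ (-γ) • z.2))
      (((volume : Measure ℝ).restrict (Iio (0 : ℝ))).prod (volume : Measure (EuclideanSpace ℝ (Fin 3))))
      volume := by
  refine MeasureTheory.QuasiMeasurePreserving.prod_of_right (measurable_spiralMap S γ) ?_
  filter_upwards [ae_restrict_mem measurableSet_Iio] with τ hτ
  have h1 := quasiMeasurePreserving_smul (Real.rpow_pos_of_pos (neg_pos.2 hτ) (-γ)).ne'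
  have h2 := (Killing.measurePreserving_expSkew (B := S) (Spiral.inner_self_of_skew hS) (-Real.log (-τ))).quasiMeasurePreserving
  exact h2.comp h1

end SpiralMap

/-! ## Fubini for one rotated–dilated term on the slab -/

section Slab

/-- **Fubini for one rotated–dilated term on the slab.**  For `g ∈ L¹(ℝ³)`, a continuous weight `α` supported in `(a, b)`, `b < 0`, and `S` skew:
`(t, x) ↦ α(t) g(e^{−(log(−t))S}((−t)^{−γ}x))` is integrable on the slab `(−∞,0) × ℝ³` and
`∫∫ α(t) g(e^{−(log(−t))S}((−t)^{−γ}x)) dx dt = (∫ α(t)(−t)^{3γ} dt)(∫ g)` (slice: dilation `Measure.integral_comp_smul`, then rotation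
`Killing.integral_comp_expSkew`; the untwisted `ProfileEquation.integral_slab_mul_comp_dilation` is `S = 0`). [folklore] -/
theorem integral_slab_mul_comp_spiral {γ a b : ℝ} (hb : b < 0) (hS : ∀ x y : EuclideanSpace ℝ (Fin 3), ⟪S x, y⟫ = -⟪x, S y⟫)
    {g : EuclideanSpace ℝ (Fin 3) → ℝ} (hg : Integrable g volume) {α : ℝ → ℝ} (hα : Continuous α) (hαs : support α ⊆ Ioo a b) :
    Integrable (fun z : ℝ × EuclideanSpace ℝ (Fin 3) =>
        α z.1 * g (NormedSpace.exp ((-Real.log (-z.1)) • S) ((-z.1) ^ (-γ) • z.2)))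
        (volume.restrict (Iio (0 : ℝ) ×ˢ (univ : Set (EuclideanSpace ℝ (Fin 3))))) ∧
      ∫ z in Iio (0 : ℝ) ×ˢ (univ : Set (EuclideanSpace ℝ (Fin 3))),
          α z.1 * g (NormedSpace.exp ((-Real.log (-z.1)) • S) ((-z.1) ^ (-γ) • z.2)) =
        (∫ t, α t * (-t) ^ (3 * γ)) * ∫ y, g y := by
  have hB := Spiral.inner_self_of_skew hS
  have hα0 : ∀ t, t ∉ Ioo a b → α t = 0 := fun t ht => notMem_support.1 fun h => ht (hαs h)
  have hα0' : ∀ t, b ≤ t → α t = 0 := fun t ht => hα0 t fun h => (not_lt.2 ht) h.2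
  -- measurability on the slab measure
  have hmeas : AEStronglyMeasurable (fun z : ℝ × EuclideanSpace ℝ (Fin 3) =>
      α z.1 * g (NormedSpace.exp ((-Real.log (-z.1)) • S) ((-z.1) ^ (-γ) • z.2)))
      (((volume : Measure ℝ).restrict (Iio 0)).prod volume) := by
    have h1 : AEStronglyMeasurable (fun z : ℝ × EuclideanSpace ℝ (Fin 3) =>
        g (NormedSpace.exp ((-Real.log (-z.1)) • S) ((-z.1) ^ (-γ) • z.2)))
        (((volume : Measure ℝ).restrict (Iio 0)).prod volume) :=
      hg.1.comp_quasiMeasurePreserving (quasiMeasurePreserving_spiralMap hS γ)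
    exact ((hα.comp continuous_fst).aestronglyMeasurable).mul h1
  -- slices: dilation then rotation
  have hslice' : ∀ (G : EuclideanSpace ℝ (Fin 3) → ℝ) (t : ℝ), t < 0 →
      ∫ x, G (NormedSpace.exp ((-Real.log (-t)) • S) ((-t) ^ (-γ) • x)) = (-t) ^ (3 * γ) * ∫ y, G y := by
    intro G t ht
    have key := Measure.integral_comp_smul (volume : Measure (EuclideanSpace ℝ (Fin 3)))
      (fun w => G (NormedSpace.exp ((-Real.log (-t)) • S) w)) ((-t) ^ (-γ))
    rw [key, finrank_euclideanSpace_fin, abs_inv_rpow_neg_pow_three (neg_pos.2 ht), smul_eq_mul,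
      Killing.integral_comp_expSkew hB]
  have hslice : ∀ t : ℝ, t < 0 →
      ∫ x, g (NormedSpace.exp ((-Real.log (-t)) • S) ((-t) ^ (-γ) • x)) = (-t) ^ (3 * γ) * ∫ y, g y :=
    fun t ht => hslice' g t ht
  have hslice_norm : ∀ t : ℝ, t < 0 →
      ∫ x, ‖g (NormedSpace.exp ((-Real.log (-t)) • S) ((-t) ^ (-γ) • x))‖ = (-t) ^ (3 * γ) * ∫ y, ‖g y‖ :=
    fun t ht => hslice' (fun y => ‖g y‖) t ht
  -- integrability of each slice: the slice map is measure-class preserving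
  have hslice_int : ∀ t : ℝ, t < 0 →
      Integrable (fun x => g (NormedSpace.exp ((-Real.log (-t)) • S) ((-t) ^ (-γ) • x))) volume := by
    intro t ht
    have h1 : Integrable (fun w => g (NormedSpace.exp ((-Real.log (-t)) • S) w)) volume :=
      (Killing.measurePreserving_expSkew hB (-Real.log (-t))).integrable_comp_of_integrable hg
    exact h1.comp_smul (Real.rpow_pos_of_pos (neg_pos.2 ht) _).ne'
  have hint : Integrable (fun z : ℝ × EuclideanSpace ℝ (Fin 3) =>
      α z.1 * g (NormedSpace.exp ((-Real.log (-z.1)) • S) ((-z.1) ^ (-γ) • z.2)))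
      (((volume : Measure ℝ).restrict (Iio 0)).prod volume) := by
    rw [integrable_prod_iff hmeas]
    constructor
    · filter_upwards [ae_restrict_mem measurableSet_Iio] with t ht
      exact (hslice_int t ht).const_mul _
    · have hc : Continuous fun t => |α t| * (-t) ^ (3 * γ) := by
        have := ProfileEquation.continuous_mul_neg_rpow hb (continuous_abs.comp hα) (fun t ht => by
          simp [hα0' t ht]) (3 * γ)
        exact this
      have hcs : HasCompactSupport fun t => |α t| * (-t) ^ (3 * γ) := by
        refine HasCompactSupport.of_support_subset_isCompact isCompact_Icc (K := Icc a b) ?_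
        intro t ht
        rw [mem_support] at ht
        have : α t ≠ 0 := fun h => ht (by simp [h])
        exact Ioo_subset_Icc_self (hαs (mem_support.2 this))
      have hi : Integrable (fun t => |α t| * (-t) ^ (3 * γ) * ∫ y, ‖g y‖) volume :=
        (hc.integrable_of_hasCompactSupport hcs).mul_const _
      refine (hi.restrict (s := Iio 0)).congr ?_
      filter_upwards [ae_restrict_mem measurableSet_Iio] with t ht
      have e : (fun x => ‖α t * g (NormedSpace.exp ((-Real.log (-t)) • S) ((-t) ^ (-γ) • x))‖) =
          fun x => |α t| * ‖g (NormedSpace.exp ((-Real.log (-t)) • S) ((-t) ^ (-γ) • x))‖ := by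
        funext x; rw [norm_mul, Real.norm_eq_abs]
      rw [e, integral_const_mul, hslice_norm t ht]
      ring
  -- Fubini
  have hμ : (volume : Measure (ℝ × EuclideanSpace ℝ (Fin 3))).restrict
      (Iio (0 : ℝ) ×ˢ (univ : Set (EuclideanSpace ℝ (Fin 3)))) =
      ((volume : Measure ℝ).restrict (Iio 0)).prod volume := by
    rw [Measure.volume_eq_prod, ← Measure.restrict_prod_eq_prod_univ]
  refine ⟨by rw [hμ]; exact hint, ?_⟩
  rw [hμ, integral_prod _ hint]
  have hae : ∀ᵐ t ∂((volume : Measure ℝ).restrict (Iio 0)),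
      (∫ x, α t * g (NormedSpace.exp ((-Real.log (-t)) • S) ((-t) ^ (-γ) • x))) = α t * (-t) ^ (3 * γ) * ∫ y, g y := by
    filter_upwards [ae_restrict_mem measurableSet_Iio] with t ht
    rw [integral_const_mul, hslice t ht, mul_assoc]
  rw [integral_congr_ae hae, integral_mul_const]
  congr 1
  refine setIntegral_eq_integral_of_forall_compl_eq_zero fun t ht => ?_
  have ht' : 0 ≤ t := not_lt.1 ht
  rw [hα0' t (hb.le.trans ht'), zero_mul]

end Slab

/-! ## The tested integrand of a spiral pair, pointwise -/

section Integrand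

/-- **The tested integrand of a spiral pair, pointwise** (`t < 0`): with `Q = e^{(log(−t))S}`, `z = Q⁻¹((−t)^{−γ}x)`, the spiral slice
`u(t,x) = (−t)^{γ−1} Q V(z)`, `p(t,x) = (−t)^{2(γ−1)} P(z)` and the spiral test field `Ψ(t,x) = χ(t) Q η(z)`,
`⟪u, ∂ₜΨ⟫ + ⟪u, DΨ(u)⟫ + p div Ψ = χ'(−t)^{γ−1}⟪V z, η z⟫ + γχ(−t)^{γ−2}⟪V z, Dη(z) z⟫ + χ(−t)^{γ−2}(⟪V z, Dη(z)(V z)⟫ + P z div η z)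
  + χ(−t)^{γ−2}(⟪V z, Dη(z)(S z)⟫ + ⟪S V z, η z⟫)` — the rotation drops out of every pairing by isometry and `Q⁻¹Q = 1`; the last bracket is
the spiral correction (`⟪Q V, S Q η⟫ = ⟪V, S η⟫ = −⟪S V, η⟫`). [folklore] -/
theorem tested_integrand_spiral {γ : ℝ} {χ : ℝ → ℝ} (hχ : Differentiable ℝ χ)
    (hS : ∀ x y : EuclideanSpace ℝ (Fin 3), ⟪S x, y⟫ = -⟪x, S y⟫)
    {η : EuclideanSpace ℝ (Fin 3) → EuclideanSpace ℝ (Fin 3)} (hη : Differentiable ℝ η)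
    (V : EuclideanSpace ℝ (Fin 3) → EuclideanSpace ℝ (Fin 3)) (P : EuclideanSpace ℝ (Fin 3) → ℝ)
    {t : ℝ} (ht : t < 0) (x : EuclideanSpace ℝ (Fin 3)) :
    ⟪(-t) ^ (γ - 1) • NormedSpace.exp ((Real.log (-t)) • S) (V (NormedSpace.exp ((-Real.log (-t)) • S) ((-t) ^ (-γ) • x))),
        timeDeriv (fun t x => χ t • NormedSpace.exp ((Real.log (-t)) • S)
          (η (NormedSpace.exp ((-Real.log (-t)) • S) ((-t) ^ (-γ) • x)))) t x⟫ +
      ⟪(-t) ^ (γ - 1) • NormedSpace.exp ((Real.log (-t)) • S) (V (NormedSpace.exp ((-Real.log (-t)) • S) ((-t) ^ (-γ) • x))),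
        fderiv ℝ (fun x => χ t • NormedSpace.exp ((Real.log (-t)) • S)
          (η (NormedSpace.exp ((-Real.log (-t)) • S) ((-t) ^ (-γ) • x)))) x
          ((-t) ^ (γ - 1) • NormedSpace.exp ((Real.log (-t)) • S)
            (V (NormedSpace.exp ((-Real.log (-t)) • S) ((-t) ^ (-γ) • x))))⟫ +
      (-t) ^ (2 * (γ - 1)) * P (NormedSpace.exp ((-Real.log (-t)) • S) ((-t) ^ (-γ) • x)) *
        VectorCalculus.divergence (fun x => χ t • NormedSpace.exp ((Real.log (-t)) • S)
          (η (NormedSpace.exp ((-Real.log (-t)) • S) ((-t) ^ (-γ) • x)))) x =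
    deriv χ t * (-t) ^ (γ - 1) *
        ⟪V (NormedSpace.exp ((-Real.log (-t)) • S) ((-t) ^ (-γ) • x)),
          η (NormedSpace.exp ((-Real.log (-t)) • S) ((-t) ^ (-γ) • x))⟫ +
      γ * (χ t * (-t) ^ (γ - 2)) *
        ⟪V (NormedSpace.exp ((-Real.log (-t)) • S) ((-t) ^ (-γ) • x)),
          fderiv ℝ η (NormedSpace.exp ((-Real.log (-t)) • S) ((-t) ^ (-γ) • x))
            (NormedSpace.exp ((-Real.log (-t)) • S) ((-t) ^ (-γ) • x))⟫ +
      χ t * (-t) ^ (γ - 2) *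
        (⟪V (NormedSpace.exp ((-Real.log (-t)) • S) ((-t) ^ (-γ) • x)),
            fderiv ℝ η (NormedSpace.exp ((-Real.log (-t)) • S) ((-t) ^ (-γ) • x))
              (V (NormedSpace.exp ((-Real.log (-t)) • S) ((-t) ^ (-γ) • x)))⟫ +
          P (NormedSpace.exp ((-Real.log (-t)) • S) ((-t) ^ (-γ) • x)) *
            VectorCalculus.divergence η (NormedSpace.exp ((-Real.log (-t)) • S) ((-t) ^ (-γ) • x))) +
      χ t * (-t) ^ (γ - 2) *
        (⟪V (NormedSpace.exp ((-Real.log (-t)) • S) ((-t) ^ (-γ) • x)),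
            fderiv ℝ η (NormedSpace.exp ((-Real.log (-t)) • S) ((-t) ^ (-γ) • x))
              (S (NormedSpace.exp ((-Real.log (-t)) • S) ((-t) ^ (-γ) • x)))⟫ +
          ⟪S (V (NormedSpace.exp ((-Real.log (-t)) • S) ((-t) ^ (-γ) • x))),
            η (NormedSpace.exp ((-Real.log (-t)) • S) ((-t) ^ (-γ) • x))⟫) := by
  have hs : 0 < -t := neg_pos.2 ht
  have hB := Spiral.inner_self_of_skew hS
  rw [timeDeriv_spiral hχ hη ht, fderiv_spiral_slice χ hη, divergence_spiral_slice χ hS hη]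
  set z : EuclideanSpace ℝ (Fin 3) := NormedSpace.exp ((-Real.log (-t)) • S) ((-t) ^ (-γ) • x) with hz
  -- `Q⁻¹` of the rescaled slice value: `Q⁻¹((−t)^{−γ} • (−t)^{γ−1} • Q V z) = ((−t)^{−γ}(−t)^{γ−1}) • V z`
  have hQiu : NormedSpace.exp ((-Real.log (-t)) • S)
      ((-t) ^ (-γ) • ((-t) ^ (γ - 1) • NormedSpace.exp ((Real.log (-t)) • S) (V z))) =
      ((-t) ^ (-γ) * (-t) ^ (γ - 1)) • V z := by
    rw [map_smul, map_smul, Killing.expSkew_neg_apply_expSkew, smul_smul]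
  rw [hQiu]
  -- the power identities
  have e1 : (-t) ^ (γ - 1) * (γ * (-t) ^ (-1 : ℝ)) = γ * (-t) ^ (γ - 2) := by
    rw [show γ - 2 = γ - 1 + (-1 : ℝ) by ring, Real.rpow_add hs]; ring
  have e1' : (-t) ^ (γ - 1) * (-t) ^ (-1 : ℝ) = (-t) ^ (γ - 2) := by
    rw [show γ - 2 = γ - 1 + (-1 : ℝ) by ring, Real.rpow_add hs]
  have e2 : (-t) ^ (γ - 1) * ((-t) ^ (-γ) * (-t) ^ (γ - 1)) = (-t) ^ (γ - 2) := by
    rw [← Real.rpow_add hs, ← Real.rpow_add hs]; congr 1; ring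
  have e3 : (-t) ^ (2 * (γ - 1)) * (-t) ^ (-γ) = (-t) ^ (γ - 2) := by
    rw [← Real.rpow_add hs]; congr 1; ring
  -- the rotation drops out of every pairing; the `S`-pairing is skew
  have hQS : ⟪NormedSpace.exp ((Real.log (-t)) • S) (V z),
      S (NormedSpace.exp ((Real.log (-t)) • S) (η z))⟫ = -⟪S (V z), η z⟫ := by
    rw [← TypeIRate.exp_smul_apply_comm, inner_expSkew_expSkew hS, hS]
    ring
  simp only [inner_add_right, inner_sub_right, inner_smul_left, inner_smul_right, map_add, map_smul,
    RCLike.conj_to_real, inner_expSkew_expSkew hS, hQS]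
  linear_combination
    (χ t * ⟪V z, fderiv ℝ η z (S z)⟫) * e1' + (χ t * ⟪V z, fderiv ℝ η z z⟫) * e1 +
      (χ t * ⟪S (V z), η z⟫) * e1' +
      (χ t * ⟪V z, fderiv ℝ η z (V z)⟫) * e2 +
      (χ t * P z * VectorCalculus.divergence η z) * e3

end Integrand

/-! ## Slice derivative of the scalar (no outer rotation) spiral composite -/

section ScalarSlice

variable {F : Type*} [NormedAddCommGroup F] [NormedSpace ℝ F]

/-- Spatial derivative of the scalar spiral composite on a slice: `D_x[χ(t) θ(e^{−(log(−t))S}((−t)^{−γ}·))](x) v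
= χ(t) Dθ(z)(e^{−(log(−t))S}((−t)^{−γ} v))`, `z = e^{−(log(−t))S}((−t)^{−γ}x)` (used with a scalar test `θ` for the weak
divergence-freeness of the profile). [folklore] -/
theorem fderiv_spiralComp_slice {γ : ℝ} (χ : ℝ → ℝ) {θ : EuclideanSpace ℝ (Fin 3) → F}
    (hθ : Differentiable ℝ θ) (t : ℝ) (x v : EuclideanSpace ℝ (Fin 3)) :
    fderiv ℝ (fun x => χ t • θ (NormedSpace.exp ((-Real.log (-t)) • S) ((-t) ^ (-γ) • x))) x v =
      χ t • fderiv ℝ θ (NormedSpace.exp ((-Real.log (-t)) • S) ((-t) ^ (-γ) • x))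
        (NormedSpace.exp ((-Real.log (-t)) • S) ((-t) ^ (-γ) • v)) := by
  set Qi : EuclideanSpace ℝ (Fin 3) →L[ℝ] EuclideanSpace ℝ (Fin 3) := NormedSpace.exp ((-Real.log (-t)) • S) with hQi
  have h0 : HasFDerivAt (fun x : EuclideanSpace ℝ (Fin 3) => (-t) ^ (-γ) • x)
      ((-t) ^ (-γ) • ContinuousLinearMap.id ℝ (EuclideanSpace ℝ (Fin 3))) x :=
    (hasFDerivAt_id x).const_smul ((-t) ^ (-γ))
  have h1 : HasFDerivAt (fun x : EuclideanSpace ℝ (Fin 3) => Qi ((-t) ^ (-γ) • x))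
      (Qi.comp ((-t) ^ (-γ) • ContinuousLinearMap.id ℝ (EuclideanSpace ℝ (Fin 3)))) x :=
    Qi.hasFDerivAt.comp x h0
  have h2 : HasFDerivAt (fun x : EuclideanSpace ℝ (Fin 3) => θ (Qi ((-t) ^ (-γ) • x)))
      ((fderiv ℝ θ (Qi ((-t) ^ (-γ) • x))).comp
        (Qi.comp ((-t) ^ (-γ) • ContinuousLinearMap.id ℝ (EuclideanSpace ℝ (Fin 3))))) x :=
    (hθ _).hasFDerivAt.comp x h1
  have h3 : HasFDerivAt (fun x : EuclideanSpace ℝ (Fin 3) => χ t • θ (Qi ((-t) ^ (-γ) • x)))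
      (χ t • ((fderiv ℝ θ (Qi ((-t) ^ (-γ) • x))).comp
        (Qi.comp ((-t) ^ (-γ) • ContinuousLinearMap.id ℝ (EuclideanSpace ℝ (Fin 3)))))) x :=
    h2.const_smul (χ t)
  rw [h3.fderiv]
  simp [map_smul]

end ScalarSlice

end SpiralProfileEquation

end Summit.NavierStokesRegularity.NavierStokesRegularity.Theorems.PowerGaugeEulerLiouville

end
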